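import Summits.PneNP.PneNP.Theses.ConvexRankGates
import Literature.Computability.Complexity.ExtMonotoneCircuits
import Literature.Computability.Complexity.CircuitComposition
import Literature.Computability.Complexity.NegationElimination
import Literature.Barriers.PneNP.MonotoneGapHolds

/-!
# `Capture` (stmt-PneNP-2659, route PneNP/ConvexRankGates) — negative-side lemmas: wide gates of bounded fan-in do not suffice

Standing-adversary (cdisprove, gen 2) output for the crux
`Summit.PneNP.PneNP.Theses.ConvexRankGates.Capture`. The natural strengthening S₂ of the crux — the
simulating circuit may use CONV/PERM/GRANK gates of any width but of FAN-IN AT MOST `k` — is FALSE for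
every `k` (`not_captureBoundedFanIn`): such a gate is merely some monotone function of `≤ k` wires
(`extGate_monotone`), hence a constant-size `{∧₂,∨₂,0,1}`-gadget; rebasing gate by gate and eliminating
constants gives a polynomial monotone-to-general transfer, refuted by the tree's proved Tardos gap
(`Literature.Barriers.PneNP.not_monotoneTransfer_pow_holds`). So any proof of `Capture` must use wide
gates of UNBOUNDED fan-in. Ingredients, reusable by provers:

* §1 `cktSize_allWires'`, `Circuit.rebase'`, `Circuit.rebase` — gate-by-gate rebasing of straight-line
  programs: `1 + m · size` gates over the new basis if every gate has an `m`-gate gadget.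
* §2 `cktSize_monotone_univ_fin` — monotone Shannon expansion `f = f|₀ ∨ (x₀ ∧ f|₁)`: every monotone
  `k`-ary function has a `{∧₂,∨₂,0,1}`-program with `monoBound k = 3·2^k − 2` gates.
* §3 `circuitSizeOver_monotoneBasis_const`, `not_captureBoundedFanIn`.

Companions: `LoadBearing.lean`, `GateLocality.lean`. Refuter seat cdisprove-stmt-PneNP-2659-g2, 2026-08-16.
-/

namespace Summit.PneNP.PneNP.Theorems.Capture.Negative

open Literature.Computability.Complexity Literature.Computability.Complexity.GateList
  Literature.Barriers.PneNP Filter Finset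

/-! ## §1 Gate-by-gate rebasing of straight-line programs (the honest content of "simulate each gate") -/

section Rebase

variable {ι : Type*} {B' : Set GateFn}

/-- All wires of a program as one multi-output map `x ↦ (w ↦ value of wire w)`; out-of-range gate
wires read `false`, as in `wireOf`. [folklore] -/
def allWires (gs : List (Gate ι)) : (ι → Bool) → ι ⊕ ℕ → Bool := fun x w => wireOf x (vals gs x) w

/-- A constant gate of the target basis costs one gate. [folklore] -/
theorem cktSize_const_of_mem (ι : Type*) {b : Bool} (hb : GateFn.const b ∈ B') :
    CktSize B' (fun (_ : ι → Bool) (_ : Unit) => b) 1 :=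
  (CktSize.gate (B := B') (ι := ι) (GateFn.const b) hb Fin.elim0).congr fun _ _ => rfl

/-- **Rebasing (wire form).** If every gate of a straight-line program, as a function of the WIRE
valuation it reads (`y ↦ g.op (y ∘ g.args)`), has a `B'`-program with at most `m` gates, and `B'` has
the constant `0`, then ALL wires of the program are computed by one `B'`-program with at most
`1 + m · #gates` gates (one layer per gate, reading the already rebased wires; no well-formedness needed:
forward references read `false` on both sides). [folklore] -/
theorem cktSize_allWires' (h0 : GateFn.const false ∈ B') (m : ℕ) :
    ∀ gs : List (Gate ι), (∀ g ∈ gs, CktSize B'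
        (fun (y : ι ⊕ ℕ → Bool) (_ : Unit) => g.op fun a => y (g.args a)) m) →
      CktSize B' (allWires gs) (1 + m * gs.length) := by
  intro gs
  induction gs using List.reverseRecOn with
  | nil =>
    intro _
    have h1 : CktSize B' (fun (x : ι → Bool) => Sum.elim x (fun (_ : Unit) => false)) (0 + 1) :=
      (CktSize.id B').pair (cktSize_const_of_mem ι h0)
    refine (h1.outMap (Sum.map _root_.id fun _ => ())).congr fun x w => ?_
    rcases w with i | j <;> simp [allWires]
  | append_singleton gs g ih =>
    intro hsim
    have hgs := ih fun g' hg' => hsim g' (List.mem_append_left _ hg')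
    have hG := hsim g (List.mem_append_right _ (List.mem_singleton_self g))
    have hstep : CktSize B' (fun (y : ι ⊕ ℕ → Bool) =>
        Sum.elim y (fun (_ : Unit) => g.op fun a => y (g.args a))) (0 + m) :=
      (CktSize.id B').pair hG
    have hcomp := hgs.comp hstep
    refine ((hcomp.outMap fun w : ι ⊕ ℕ => match w with
      | .inl i => Sum.inl (Sum.inl i)
      | .inr j => if j = gs.length then Sum.inr () else Sum.inl (Sum.inr j)).of_le
        (by simp; ring_nf; omega)).congr fun x w => ?_
    rcases w with i | j
    · simp [allWires]
    · by_cases hj : j = gs.length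
      · subst hj
        simp only [if_true, Sum.elim_inr, allWires, wireOf_inr, vals_append_singleton]
        rw [List.getD_append_right _ _ _ _ (length_vals gs x).le, length_vals, Nat.sub_self,
          List.getD_cons_zero]
      · simp only [hj, if_false, Sum.elim_inl, allWires, wireOf_inr, vals_append_singleton]
        rcases lt_or_gt_of_ne hj with hlt | hgt
        · rw [List.getD_append _ _ _ _ (by rw [length_vals]; exact hlt)]
        · rw [List.getD_eq_default _ _ (by rw [length_vals]; omega),
            List.getD_eq_default _ _ (by
              rw [List.length_append, length_vals, List.length_singleton]; omega)]

/-- **Rebasing (gate form).** The same with the hypothesis on each gate as a function of ITS OWN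
argument tuple. [folklore] -/
theorem cktSize_allWires (h0 : GateFn.const false ∈ B') (m : ℕ) (gs : List (Gate ι))
    (hsim : ∀ g ∈ gs, CktSize B' (fun (z : Fin g.arity → Bool) (_ : Unit) => g.op z) m) :
    CktSize B' (allWires gs) (1 + m * gs.length) :=
  cktSize_allWires' h0 m gs fun g hg => (hsim g hg).rewire g.args

/-- **Rebasing a circuit (wire form).** [folklore] -/
theorem Circuit.rebase' (h0 : GateFn.const false ∈ B') (m : ℕ) (C : Circuit ι)
    (hsim : ∀ g ∈ C.gates, CktSize B'
      (fun (y : ι ⊕ ℕ → Bool) (_ : Unit) => g.op fun a => y (g.args a)) m) :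
    ∃ C' : Circuit ι, C'.IsOver B' ∧ C'.size ≤ 1 + m * C.size ∧ ∀ x, C'.eval x = C.eval x := by
  have h := ((cktSize_allWires' h0 m C.gates hsim).outMap fun _ : Unit => C.output).toCircuit
  obtain ⟨C', hB, hs, he⟩ := h
  exact ⟨C', hB, hs, fun x => by rw [he, circuit_eval]; rfl⟩

/-- **Rebasing a circuit (gate form).** Under the gate-wise hypothesis a circuit becomes a circuit over
`B'` with at most `1 + m · size` gates computing the same function. [folklore] -/
theorem Circuit.rebase (h0 : GateFn.const false ∈ B') (m : ℕ) (C : Circuit ι)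
    (hsim : ∀ g ∈ C.gates, CktSize B' (fun (z : Fin g.arity → Bool) (_ : Unit) => g.op z) m) :
    ∃ C' : Circuit ι, C'.IsOver B' ∧ C'.size ≤ 1 + m * C.size ∧ ∀ x, C'.eval x = C.eval x :=
  Circuit.rebase' h0 m C fun g hg => (hsim g hg).rewire g.args

end Rebase

/-! ## §2 Every MONOTONE function of `k` variables has a `{∧₂,∨₂,0,1}`-program of size `≤ monoBound k` -/

/-- Size of the monotone Shannon expansion `f = f|₀ ∨ (x₀ ∧ f|₁)`: `monoBound 0 = 1`,
`monoBound (k+1) = 2·monoBound k + 2` (`= 3·2^k − 2`). [folklore] -/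
def monoBound : ℕ → ℕ
  | 0 => 1
  | k + 1 => 2 * monoBound k + 2

/-- `monoBound` is monotone. [folklore] -/
theorem monoBound_mono : Monotone monoBound := by
  refine monotone_nat_of_le_succ fun k => ?_
  simp only [monoBound]; omega

/-- `∧₂ ∈ {∧₂,∨₂,0,1}`. [folklore] -/
theorem and_mem_monotoneBasis01 : GateFn.and 2 ∈ monotoneBasis01 :=
  monotoneBasis_subset_monotoneBasis01 (Set.mem_insert _ _)

/-- `∨₂ ∈ {∧₂,∨₂,0,1}`. [folklore] -/
theorem or_mem_monotoneBasis01 : GateFn.or 2 ∈ monotoneBasis01 :=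
  monotoneBasis_subset_monotoneBasis01 (Set.mem_insert_of_mem _ (Set.mem_singleton _))

/-- `0, 1 ∈ {∧₂,∨₂,0,1}`. [folklore] -/
theorem const_mem_monotoneBasis01 (b : Bool) : GateFn.const b ∈ monotoneBasis01 := by
  cases b
  · exact Set.mem_insert_of_mem _ (Set.mem_insert _ _)
  · exact Set.mem_insert _ _

/-- The monotone multiplexer `b ∨ (c ∧ a)` on three given wires costs `2` gates over `{∧₂,∨₂,0,1}`.
[folklore] -/
theorem cktSize_monoMux {ι : Type*} (c a b : ι) :
    CktSize monotoneBasis01 (fun (x : ι → Bool) (_ : Unit) => (x b || (x c && x a))) 2 := by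
  have h1 : CktSize monotoneBasis01 (fun (x : ι → Bool) =>
      Sum.elim x (fun (_ : Unit) => (x c && x a))) (0 + 1) :=
    (CktSize.id monotoneBasis01).pair
      ((CktSize.gate (B := monotoneBasis01) (GateFn.and 2) and_mem_monotoneBasis01 ![c, a]).congr
        fun x _ => by
          simp only [GateFn.and, Fin.forall_fin_two, Matrix.cons_val_zero, Matrix.cons_val_one,
            Bool.decide_and, Bool.decide_eq_true])
  have h2 : CktSize monotoneBasis01 (fun (y : ι ⊕ Unit → Bool) (_ : Unit) =>
      (y (.inl b) || y (.inr ()))) 1 :=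
    (CktSize.gate (B := monotoneBasis01) (GateFn.or 2) or_mem_monotoneBasis01
      ![Sum.inl b, Sum.inr ()]).congr fun y _ => by
        simp only [GateFn.or, Fin.exists_fin_two, Matrix.cons_val_zero, Matrix.cons_val_one,
          Bool.decide_or, Bool.decide_eq_true]
  exact (h1.comp h2).congr fun x _ => by simp

/-- **Monotone Shannon expansion.** Every MONOTONE Boolean function of `k` variables is computed by a
program over `{∧₂, ∨₂, 0, 1}` with at most `monoBound k` gates (`f = f|_{x₀=0} ∨ (x₀ ∧ f|_{x₀=1})`,
valid exactly because `f|₀ ≤ f|₁`). [folklore] -/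
theorem cktSize_monotone_univ_fin : ∀ (k : ℕ) (f : (Fin k → Bool) → Unit → Bool), Monotone f →
    CktSize monotoneBasis01 f (monoBound k)
  | 0, f, _ => (cktSize_const_of_mem (Fin 0) (const_mem_monotoneBasis01 (f Fin.elim0 ()))).congr
      fun x u => by rw [Subsingleton.elim x Fin.elim0]
  | k + 1, f, hf => by
    have hc : ∀ b : Bool, CktSize monotoneBasis01 (fun (x : Fin (k + 1) → Bool) (u : Unit) =>
        f (Fin.cons b fun i => x i.succ) u) (monoBound k) := fun b =>
      (cktSize_monotone_univ_fin k (fun x' => f (Fin.cons b x'))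
        (fun x y hxy => hf (Fin.cons_le_cons.2 ⟨le_rfl, hxy⟩))).rewire Fin.succ
    have h1 : CktSize monotoneBasis01 (fun (x : Fin (k + 1) → Bool) =>
        Sum.elim x (Sum.elim (fun u => f (Fin.cons true fun i => x i.succ) u)
          (fun u => f (Fin.cons false fun i => x i.succ) u)))
        (0 + (monoBound k + monoBound k)) :=
      (CktSize.id monotoneBasis01).pair ((hc true).pair (hc false))
    have h2 := h1.comp (cktSize_monoMux (ι := Fin (k + 1) ⊕ (Unit ⊕ Unit))
      (.inl 0) (.inr (.inl ())) (.inr (.inr ())))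
    refine (h2.of_le (by simp [monoBound]; omega)).congr fun x u => ?_
    obtain ⟨⟩ := u
    induction x using Fin.consCases with
    | _ b y =>
      have hle : f (Fin.cons false y) () ≤ f (Fin.cons true y) () :=
        hf (Fin.cons_le_cons.2 ⟨Bool.false_le _, le_rfl⟩) ()
      cases b
      · simp
      · simp only [Sum.elim_inl, Fin.cons_zero, Sum.elim_inr, Fin.cons_succ, Bool.true_and]
        revert hle
        cases f (Fin.cons false y) () <;> cases f (Fin.cons true y) () <;> simp

/-- A monotone gate of fan-in `≤ k` has a `{∧₂,∨₂,0,1}`-program of size `≤ monoBound k`. [folklore] -/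
theorem cktSize_of_monotone_gate {k : ℕ} (g : GateFn) (hg : Monotone g.2) (hk : g.1 ≤ k) :
    CktSize monotoneBasis01 (fun (z : Fin g.1 → Bool) (_ : Unit) => g.2 z) (monoBound k) :=
  (cktSize_monotone_univ_fin g.1 (fun z _ => g.2 z) (fun _ _ h _ => hg h)).of_le (monoBound_mono hk)

/-! ## §3 STRENGTHENING S₂ — wide gates of BOUNDED FAN-IN: false for every bound -/

/-- No `{∧₂, ∨₂}`-circuit computes a constant function: at the all-`b` input every in-range wire
carries `b` (`b ∧ b = b ∨ b = b`). [folklore] -/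
theorem wireOf_const_of_monotoneBasis {ι : Type*} (b : Bool) :
    ∀ gs : List (Gate ι), WF gs → (∀ g ∈ gs, g.fn ∈ monotoneBasis) →
      ∀ w : ι ⊕ ℕ, (∀ m, w = .inr m → m < gs.length) →
        wireOf (fun _ => b) (vals gs fun _ => b) w = b := by
  intro gs
  induction gs using List.reverseRecOn with
  | nil =>
    rintro - - (i | m) hw
    · rfl
    · exact absurd (hw m rfl) (Nat.not_lt_zero _)
  | append_singleton gs g ih =>
    intro hwf hB
    have ih' := ih hwf.of_append_left fun g' hg' => hB g' (List.mem_append_left _ hg')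
    rintro (i | m) hw
    · rfl
    · have hm : m < gs.length + 1 := by simpa using hw m rfl
      simp only [wireOf_inr, vals_append_singleton]
      rcases Nat.lt_or_ge m gs.length with hlt | hge
      · rw [List.getD_append _ _ _ _ (by rw [length_vals]; exact hlt)]
        exact ih' (.inr m) fun m' h => by cases h; exact hlt
      · have hmeq : m = gs.length := by omega
        subst hmeq
        rw [List.getD_append_right _ _ _ _ (length_vals gs _).le, length_vals, Nat.sub_self,
          List.getD_cons_zero]
        -- `g` is `∧₂` or `∨₂`; its arguments are in-range wires (well-formedness), all carrying `b`
        have hgB := hB g (List.mem_append_right _ (List.mem_singleton_self g))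
        have hargs : ∀ a, wireOf (fun _ => b) (vals gs fun _ => b) (g.args a) = b := fun a =>
          ih' (g.args a) fun m' hm' => hwf.getLast a m' hm'
        rcases hgB with h | h
        · obtain ⟨u, v, rfl⟩ := exists_eq_andGate_of_fn_eq h
          have hu := hargs (0 : Fin 2)
          have hv := hargs (1 : Fin 2)
          cases b <;> simp_all [andGate, GateFn.and, Fin.forall_fin_two]
        · rw [Set.mem_singleton_iff] at h
          obtain ⟨u, v, rfl⟩ := exists_eq_orGate_of_fn_eq h
          have hu := hargs (0 : Fin 2)
          have hv := hargs (1 : Fin 2)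
          cases b <;> simp_all [orGate, GateFn.or, Fin.exists_fin_two]

/-- Hence no circuit over `{∧₂, ∨₂}` computes a constant, and the monotone complexity of a constant is
the junk value `0`. [folklore] -/
theorem circuitSizeOver_monotoneBasis_const {ι : Type*} (b : Bool) :
    circuitSizeOver monotoneBasis (fun _ : ι → Bool => b) = 0 := by
  rw [circuitSizeOver, Nat.sInf_eq_zero]
  refine Or.inr (Set.eq_empty_iff_forall_notMem.2 ?_)
  rintro s ⟨C, hB, hC, -⟩
  have hw : ∀ m, C.output = .inr m → m < C.gates.length := C.wf_output
  have h1 := wireOf_const_of_monotoneBasis (!b) C.gates (wf_gates C) hB C.output hw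
  have h2 := hC fun _ => !b
  rw [circuit_eval] at h2
  rw [h2] at h1
  cases b <;> simp at h1

/-- STRENGTHENING S₂ — capture by wide gates of FAN-IN AT MOST `k` (any CONV/PERM/GRANK gate allowed, of
any width, provided it reads `≤ k` wires). [folklore] -/
def CaptureBoundedFanIn (k : ℕ) : Prop :=
  ∃ a : ℕ, ∀ (ι : Type) (_ : Fintype ι) (f : (ι → Bool) → Bool), Monotone f →
    ∀ C : Circuit ι, C.IsOver B2 → C.Computes f →
      ∃ C' : Circuit ι, C'.IsOver (extGate ((C.size + Fintype.card ι + 2) ^ a) ∩ {g | g.1 ≤ k}) ∧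
        C'.size ≤ (C.size + Fintype.card ι + 2) ^ a ∧ C'.Computes f

/-- `#E(K_v) ≤ v²`. [folklore] -/
theorem card_edgeSet_top_le' (v : ℕ) [Fintype ((⊤ : SimpleGraph (Fin v)).edgeSet)] :
    Fintype.card ((⊤ : SimpleGraph (Fin v)).edgeSet) ≤ v ^ 2 :=
  calc Fintype.card ((⊤ : SimpleGraph (Fin v)).edgeSet)
      ≤ Fintype.card (Sym2 (Fin v)) := Fintype.card_le_of_injective Subtype.val Subtype.val_injective
    _ ≤ Fintype.card (Fin v × Fin v) :=
        Fintype.card_le_of_surjective (Sym2.mk (α := Fin v)).uncurry Sym2.mk_surjective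
    _ = v ^ 2 := by simp [sq]

/-- Size bookkeeping: `1 + m (t + v² + 2)^a ≤ (v + t)^{3a+1}` once `v ≥ 2` and `v ≥ m + 1`. [folklore] -/
theorem size_bookkeeping' {v t m a : ℕ} (hv : 2 ≤ v) (hm : m + 1 ≤ v) :
    1 + m * (t + v ^ 2 + 2) ^ a ≤ (v + t) ^ (3 * a + 1) := by
  have h1 : v ^ 2 + 2 ≤ v ^ 3 := by nlinarith
  have h2 : v ^ 3 + t ≤ (v + t) ^ 3 := by
    have h3 : 1 ≤ 3 * v ^ 2 + 3 * v * t + t ^ 2 := by nlinarith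
    calc v ^ 3 + t = v ^ 3 + t * 1 := by ring
      _ ≤ v ^ 3 + t * (3 * v ^ 2 + 3 * v * t + t ^ 2) := by gcongr
      _ = (v + t) ^ 3 := by ring
  have hN : (t + v ^ 2 + 2) ^ a ≤ (v + t) ^ (3 * a) := by
    rw [pow_mul]; exact Nat.pow_le_pow_left (by omega) a
  have hpos : 1 ≤ (t + v ^ 2 + 2) ^ a := Nat.one_le_pow _ _ (by omega)
  calc 1 + m * (t + v ^ 2 + 2) ^ a ≤ (t + v ^ 2 + 2) ^ a + m * (t + v ^ 2 + 2) ^ a := by omega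
    _ = (m + 1) * (t + v ^ 2 + 2) ^ a := by ring
    _ ≤ (v + t) * (v + t) ^ (3 * a) := Nat.mul_le_mul (by omega) hN
    _ = (v + t) ^ (3 * a + 1) := by ring

/-- **The strengthening "wide gates of bounded fan-in" is FALSE, for every bound `k`.** A CONV/PERM/GRANK
gate reading `≤ k` wires is just SOME monotone function of `≤ k` wires (`extGate_monotone`), hence a
`{∧₂,∨₂,0,1}`-gadget of constant size `monoBound k` (§2); rebasing (§1) turns the simulating circuit into
a `{∧₂,∨₂,0,1}`-circuit of size `≤ 1 + monoBound k · N^a`, constants are eliminated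
(`const_or_exists_monotone_circuit`), and the tree's PROVED Tardos gap (`not_monotoneTransfer_pow_holds`)
refutes the resulting polynomial monotone-to-general transfer. So any proof of `Capture` must use wide
gates of UNBOUNDED fan-in (growing with `t + n`). [cite: Tardos1988] -/
theorem not_captureBoundedFanIn (k : ℕ) : ¬ CaptureBoundedFanIn k := by
  rintro ⟨a, h⟩
  refine not_monotoneTransfer_pow_holds (3 * a + 1) ?_
  filter_upwards [eventually_ge_atTop (monoBound k + 2)] with v hv f hf C hB hC
  obtain ⟨C', h1, h2, h3⟩ := h _ inferInstance f hf C (hB.mono deMorganBasis_subset_B2) hC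
  -- rebase `C'` gate by gate into `{∧₂,∨₂,0,1}`
  obtain ⟨C'', hB'', hs'', he''⟩ := Circuit.rebase (const_mem_monotoneBasis01 false) (monoBound k) C'
    fun g hg => by
      obtain ⟨hgE, hgk⟩ := h1 g hg
      exact cktSize_of_monotone_gate g.fn (extGate_monotone hgE) hgk
  -- eliminate the constants
  rcases const_or_exists_monotone_circuit C''.gates C''.output (wf_gates C'') hB'' C''.wf_output with
    ⟨b, hb⟩ | ⟨D, hDB, hDs, hDe⟩
  · have hfb : f = fun _ => b := funext fun x => by rw [← h3 x, ← he'' x, circuit_eval, hb x]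
    rw [hfb, circuitSizeOver_monotoneBasis_const]
    exact Nat.zero_le _
  · calc circuitSizeOver monotoneBasis f ≤ D.size :=
          circuitSizeOver_le_of_computes D hDB fun x => by rw [hDe, ← circuit_eval, he'', h3]
      _ ≤ C''.size := hDs
      _ ≤ 1 + monoBound k * C'.size := hs''
      _ ≤ 1 + monoBound k * (C.size + Fintype.card ((⊤ : SimpleGraph (Fin v)).edgeSet) + 2) ^ a :=
          by gcongr
      _ ≤ 1 + monoBound k * (C.size + v ^ 2 + 2) ^ a := by
          have := card_edgeSet_top_le' v
          gcongr
      _ ≤ (v + C.size) ^ (3 * a + 1) := size_bookkeeping' (by omega) (by omega)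

end Summit.PneNP.PneNP.Theorems.Capture.Negative
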